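import Summits.BirchSwinnertonDyer.BirchSwinnertonDyer.Theorems.QuadraticBranchSignedControlPlusEtaNonsurjConjADoorHeckeRecordsA
import HarnessLib

/-!
# Route `QuadraticBranchSignedControl` (rung K8, cell `bsd-potss`), residual crux `PlusEtaMainConjectureNonsurj`
# (stmt-BirchSwinnertonDyer-19606): RECORDS THROUGH THE HECKE DOOR, part B — (C1⁺_η) at `p = 5` on 148225cc1, 378225bg1, 326700ga1
# (seat `bsd-potss-k8eta-c2` g21; continuation of `…ConjADoorHeckeRecordsA`, same shape `etaMC_r1_of_heckeEigenHom`; kit j326603 / j326822, GRH)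

WHAT. The remaining three of the six prime-`L` rank-one rows of the k8eta-c2 g21 classification at `p = 5` whose only class-group door is the
Hecke-refined eigen-test (`E5-CLASSIFICATION-k8eta-c2-g21.tsv`, door `PASS:L4 Hecke`): `148225cc1 = [1,−1,0,−6617,256416]` (`h/hₓ = 40/1`, hecke13
TWIST `c = 2 ≠ Tr = 3`), `378225bg1 = [0,0,1,0,1281]` (`1200/30`, `j = 0`, the cubic-twist companion row: hecke13 `T = 0`, `Tr = 2`; `d₁ = d₂ = 1`,
`s_W = s_V = 0`), `326700ga1 = [0,0,0,0,−1375]` (`360/18`, TWIST `c = 3 ≠ Tr = 2`); Cremona `r_an(W) = 1`, PARI plus-`η` `(λ, μ) = (1, 0)` on each.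
Instances of `EtaConjADoorHeckeRecords.etaMC_r1_of_heckeEigenHom` (named facts `h22 h41 h6273 hGZK`; displayed `r_an(W) = 1`, the tower clause,
`(L_5⁺(V,η,X)) = (X)`, the Hecke-refined eigen datum on `Cl(ℚ(P)) ⊗ 𝔽₅`).

HONEST FRAMING (cell `bsd-potss`; FULL-BSD rank ≤ 1 programme, HUMAN RULING D-0036/D-0074): per-row RECORDS, CONDITIONAL on the displayed named
facts and per-row inputs; the class-group / Hecke data are GRH numerics (evidence, not facts); no stub of 19606 is proved by name; the crux stays
OPEN; nothing is booked; `BSD(W,5)` is claimed for no pair. `--supports stmt-BirchSwinnertonDyer-19606`.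

References: [Kobayashi2003] §4 (p. 8), Thm. 4.1; [CoatesSujatha2005] §3 (A); [DeoRaySujatha2023] Thm. 3.8; [GrossZagier1986] Thm. (7.3); [Kolyvagin1990] Thm. A;
[Cremona1997] Table 1 (labels as listed).
-/

set_option autoImplicit false
set_option linter.dupNamespace false
noncomputable section

open scoped Classical nonZeroDivisors

open CongruenceSubgroup NumberField Field WeierstrassCurve
open Literature.NumberTheory.EllipticCurves Literature.NumberTheory.EllipticCurves.ModularForms
  Literature.NumberTheory.EllipticCurves.Rank1Residual Literature.NumberTheory.EllipticCurves.Rank1Residual.Typed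
  Literature.NumberTheory.GaloisRepresentations Literature.NumberTheory.GaloisCohomology Literature.NumberTheory.NumberFields
  Literature.NumberTheory.EllipticCurves.GreenbergVatsal2000 ZpExtension
open Summit.BirchSwinnertonDyer.Rank1Residual Summit.BirchSwinnertonDyer.Rank1Residual.Additive
open Summit.BirchSwinnertonDyer.Rank1Residual.X11b (isElliptic_of_discOf_ne_zero)
open Summit.BirchSwinnertonDyer.BirchSwinnertonDyer.Theorems

namespace Summit.BirchSwinnertonDyer.BirchSwinnertonDyer.Theorems.EtaConjADoorHeckeRecords

/-- `148225cc1` = `[1, -1, 0, -6617, 256416]` (CM, `N = 148225`): `Δ ≠ 0` (kernel). [cite: Cremona1997, Table 1 (label 148225cc1)] -/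
theorem isElliptic_148225cc1 : (⟨1, (-1), 0, (-6617), 256416⟩ : WeierstrassCurve ℚ).IsElliptic :=
  isElliptic_of_discOf_ne_zero 1 (-1) 0 (-6617) 256416 (by decide +kernel)

/-- **(C1⁺_η) at `p = 5` for every good `a_5 = 0` model `V` of the `5`-twist of `148225cc1`** (`W = [1, -1, 0, -6617, 256416]`, CM, `N = 148225`;
Cremona `r_an(W) = 1`; PARI plus-`η` `(λ, μ) = (1, 0)`; census j326603 / j326929 / j326822 (GRH): `h(ℚ(P)) = 40`, `h(ℚ(x(P))) = 1`, `d₂ = 1`, `s_W = 0`; hecke13: TWIST, `c = 2 ≠ Tr = 3` — the plain class-number door and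
door L6⁻ are VOID, the Hecke door passes: the tautological class comes from the ROW curve `V = W^5`, not from `W`) from the ROW ALONE —
named facts `h22 h41 h6273 hGZK`; displayed `r_an(W) = 1`, the tower clause, `(L_5⁺(V,η,X)) = (X)`, the Hecke-refined eigen datum. Instance of
`etaMC_r1_of_heckeEigenHom`. CONDITIONAL; nothing booked. [cite: Kobayashi2003, §4 (p. 8)] [cite: DeoRaySujatha2023, §3 Thm. 3.8]
[cite: Cremona1997, Table 1 (label 148225cc1)] -/
theorem etaMC_r1_148225cc1_5_of_heckeEigenHom
    (h22 : Kobayashi2003.thm22_etaSignedSelmerDual_finite_torsion)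
    (h41 : Kobayashi2003.thm41_plusEtaCharIdeal_dvd)
    (h6273 : Kobayashi2003.thm62_63_73_etaColemanPoitouTate)
    (hGZK : rank_eq_analyticRank_of_analyticRank_le_one) [Fact (5 : ℕ).Prime]
    (W : WeierstrassCurve ℚ) (hW : W = (⟨1, (-1), 0, (-6617), 256416⟩ : WeierstrassCurve ℚ)) (hr : W.analyticRank = 1)
    (V : WeierstrassCurve ℚ) [V.IsElliptic] [V.IsGloballyMinimal] (C : VariableChange ℚ)
    (hC : C • W.quadraticTwist 5 = V)
    (hgood : V.HasGoodReductionAtPrime 5) (hap : V.frobeniusTrace 5 = 0)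
    (hns : ¬ ∀ m : ℕ, V.HasSurjectiveModNGaloisRep (5 ^ m : ℕ))
    (hX : ∀ {N : ℕ} [NeZero N] {f : CuspForm (Gamma0 N) 2}, IsNewformOf V f →
      ∀ (ϖ : ℚ), (if Even (5 / 2) then (ϖ : ℝ) * V.realPeriodRat = plusPeriod f
          else (ϖ : ℝ) * V.imaginaryPeriodRat = minusPeriod f) →
      ∀ (Lη : IwasawaAlgebra 5), IsQuadraticBranchPlusLFunction f 5 ϖ Lη →
        Ideal.span {Lη} = Ideal.span {(PowerSeries.X : IwasawaAlgebra 5)})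
    (hP : haveI : W.IsElliptic := hW ▸ isElliptic_148225cc1
      haveI : NeZero (5 : ℕ) := ⟨by norm_num⟩
      haveI : NumberField (W.divisionField 5) := NumberField.mk
      ∃ P : geomTorsion W ((5 : ℕ) : ℤ), P ≠ 0 ∧
        ∀ K : IntermediateField ℚ (W.divisionField 5),
          K = IntermediateField.fixedField
            ((MulAction.stabilizer (absoluteGaloisGroup ℚ) P).map (absRestrictNormalHom (W.divisionField 5))) →
        ∀ μ : Additive (ClassGroup (𝓞 K)) →+ ZMod 5,
          (∀ (τ : absoluteGaloisGroup ℚ) (σ : K ≃ₐ[ℚ] K) (a : ℕ),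
              (∀ x : K, absRestrictNormalHom (W.divisionField 5) τ (x : W.divisionField 5) =
                ((σ x : K) : W.divisionField 5)) → τ • P = a • P →
              ∀ (I J : (Ideal (𝓞 K))⁰),
                (J : Ideal (𝓞 K)) = (I : Ideal (𝓞 K)).map (AmbiguousClass.intAut σ : 𝓞 K →+* 𝓞 K) →
                μ (Additive.ofMul (ClassGroup.mk0 J)) = a • μ (Additive.ofMul (ClassGroup.mk0 I))) →
          (∀ (τ τ₁ : absoluteGaloisGroup ℚ) (a a₁ b : ℕ) (Q : geomTorsion W ((5 : ℕ) : ℤ)),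
              τ • P = a • P + Q → τ₁ • P = a₁ • P → τ₁ • Q = b • Q → (a₁ : ZMod 5) ≠ (b : ZMod 5) →
              ∀ I : (Ideal (𝓞 K))⁰,
                μ (Additive.ofMul (classGroupNorm K (W.divisionField 5) (ClassGroup.mulEquiv
                  (AmbiguousClass.intAut (absRestrictNormalHom (W.divisionField 5) τ))
                    (classGroupExtend K (W.divisionField 5) (ClassGroup.mk0 I))))) =
                  (Nat.card ((W.divisionField 5) ≃ₐ[K] (W.divisionField 5)) * a) •
                    μ (Additive.ofMul (ClassGroup.mk0 I))) →
          μ = 0) :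
    QuadraticBranchPlusEtaMainConjectureAt V 5 := by
  subst hW
  haveI : (⟨1, (-1), 0, (-6617), 256416⟩ : WeierstrassCurve ℚ).IsElliptic := isElliptic_148225cc1
  haveI : NeZero (5 : ℕ) := ⟨by norm_num⟩
  exact etaMC_r1_of_heckeEigenHom h22 h41 h6273 hGZK 5 (le_refl 5) _ hr V C
    (by rw [show ((-1 : ℚ) ^ ((5 : ℕ) / 2) * ((5 : ℕ) : ℚ)) = 5 by norm_num]; exact hC) hgood hap hns hX hP

/-- `378225bg1` = `[0, 0, 1, 0, 1281]` (CM, `j = 0`, `N = 378225`): `Δ ≠ 0` (kernel). [cite: Cremona1997, Table 1 (label 378225bg1)] -/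
theorem isElliptic_378225bg1 : (⟨0, 0, 1, 0, 1281⟩ : WeierstrassCurve ℚ).IsElliptic :=
  isElliptic_of_discOf_ne_zero 0 0 1 0 1281 (by decide +kernel)

/-- **(C1⁺_η) at `p = 5` for every good `a_5 = 0` model `V` of the `5`-twist of `378225bg1`** (`W = [0, 0, 1, 0, 1281]`, CM, `j = 0`, `N = 378225`;
Cremona `r_an(W) = 1`; PARI plus-`η` `(λ, μ) = (1, 0)`; census j326603 / j326929 / j326822 (GRH): `h(ℚ(P)) = 1200`, `h(ℚ(x(P))) = 30` (`v₅ = 2 > 1`: door L6⁻ void), `d₁ = d₂ = 1`, `s_W = s_V = 0` (cubic-twist companion); hecke13: `T = 0` (`c = 0 ≠ Tr = 2`) — the plain class-number door and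
door L6⁻ are VOID, the Hecke door passes: the tautological class comes from the ROW curve `V = W^5`, not from `W`) from the ROW ALONE —
named facts `h22 h41 h6273 hGZK`; displayed `r_an(W) = 1`, the tower clause, `(L_5⁺(V,η,X)) = (X)`, the Hecke-refined eigen datum. Instance of
`etaMC_r1_of_heckeEigenHom`. CONDITIONAL; nothing booked. [cite: Kobayashi2003, §4 (p. 8)] [cite: DeoRaySujatha2023, §3 Thm. 3.8]
[cite: Cremona1997, Table 1 (label 378225bg1)] -/
theorem etaMC_r1_378225bg1_5_of_heckeEigenHom
    (h22 : Kobayashi2003.thm22_etaSignedSelmerDual_finite_torsion)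
    (h41 : Kobayashi2003.thm41_plusEtaCharIdeal_dvd)
    (h6273 : Kobayashi2003.thm62_63_73_etaColemanPoitouTate)
    (hGZK : rank_eq_analyticRank_of_analyticRank_le_one) [Fact (5 : ℕ).Prime]
    (W : WeierstrassCurve ℚ) (hW : W = (⟨0, 0, 1, 0, 1281⟩ : WeierstrassCurve ℚ)) (hr : W.analyticRank = 1)
    (V : WeierstrassCurve ℚ) [V.IsElliptic] [V.IsGloballyMinimal] (C : VariableChange ℚ)
    (hC : C • W.quadraticTwist 5 = V)
    (hgood : V.HasGoodReductionAtPrime 5) (hap : V.frobeniusTrace 5 = 0)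
    (hns : ¬ ∀ m : ℕ, V.HasSurjectiveModNGaloisRep (5 ^ m : ℕ))
    (hX : ∀ {N : ℕ} [NeZero N] {f : CuspForm (Gamma0 N) 2}, IsNewformOf V f →
      ∀ (ϖ : ℚ), (if Even (5 / 2) then (ϖ : ℝ) * V.realPeriodRat = plusPeriod f
          else (ϖ : ℝ) * V.imaginaryPeriodRat = minusPeriod f) →
      ∀ (Lη : IwasawaAlgebra 5), IsQuadraticBranchPlusLFunction f 5 ϖ Lη →
        Ideal.span {Lη} = Ideal.span {(PowerSeries.X : IwasawaAlgebra 5)})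
    (hP : haveI : W.IsElliptic := hW ▸ isElliptic_378225bg1
      haveI : NeZero (5 : ℕ) := ⟨by norm_num⟩
      haveI : NumberField (W.divisionField 5) := NumberField.mk
      ∃ P : geomTorsion W ((5 : ℕ) : ℤ), P ≠ 0 ∧
        ∀ K : IntermediateField ℚ (W.divisionField 5),
          K = IntermediateField.fixedField
            ((MulAction.stabilizer (absoluteGaloisGroup ℚ) P).map (absRestrictNormalHom (W.divisionField 5))) →
        ∀ μ : Additive (ClassGroup (𝓞 K)) →+ ZMod 5,
          (∀ (τ : absoluteGaloisGroup ℚ) (σ : K ≃ₐ[ℚ] K) (a : ℕ),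
              (∀ x : K, absRestrictNormalHom (W.divisionField 5) τ (x : W.divisionField 5) =
                ((σ x : K) : W.divisionField 5)) → τ • P = a • P →
              ∀ (I J : (Ideal (𝓞 K))⁰),
                (J : Ideal (𝓞 K)) = (I : Ideal (𝓞 K)).map (AmbiguousClass.intAut σ : 𝓞 K →+* 𝓞 K) →
                μ (Additive.ofMul (ClassGroup.mk0 J)) = a • μ (Additive.ofMul (ClassGroup.mk0 I))) →
          (∀ (τ τ₁ : absoluteGaloisGroup ℚ) (a a₁ b : ℕ) (Q : geomTorsion W ((5 : ℕ) : ℤ)),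
              τ • P = a • P + Q → τ₁ • P = a₁ • P → τ₁ • Q = b • Q → (a₁ : ZMod 5) ≠ (b : ZMod 5) →
              ∀ I : (Ideal (𝓞 K))⁰,
                μ (Additive.ofMul (classGroupNorm K (W.divisionField 5) (ClassGroup.mulEquiv
                  (AmbiguousClass.intAut (absRestrictNormalHom (W.divisionField 5) τ))
                    (classGroupExtend K (W.divisionField 5) (ClassGroup.mk0 I))))) =
                  (Nat.card ((W.divisionField 5) ≃ₐ[K] (W.divisionField 5)) * a) •
                    μ (Additive.ofMul (ClassGroup.mk0 I))) →
          μ = 0) :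
    QuadraticBranchPlusEtaMainConjectureAt V 5 := by
  subst hW
  haveI : (⟨0, 0, 1, 0, 1281⟩ : WeierstrassCurve ℚ).IsElliptic := isElliptic_378225bg1
  haveI : NeZero (5 : ℕ) := ⟨by norm_num⟩
  exact etaMC_r1_of_heckeEigenHom h22 h41 h6273 hGZK 5 (le_refl 5) _ hr V C
    (by rw [show ((-1 : ℚ) ^ ((5 : ℕ) / 2) * ((5 : ℕ) : ℚ)) = 5 by norm_num]; exact hC) hgood hap hns hX hP

/-- `326700ga1` = `[0, 0, 0, 0, -1375]` (CM, `j = 0`, `N = 326700`): `Δ ≠ 0` (kernel). [cite: Cremona1997, Table 1 (label 326700ga1)] -/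
theorem isElliptic_326700ga1 : (⟨0, 0, 0, 0, (-1375)⟩ : WeierstrassCurve ℚ).IsElliptic :=
  isElliptic_of_discOf_ne_zero 0 0 0 0 (-1375) (by decide +kernel)

/-- **(C1⁺_η) at `p = 5` for every good `a_5 = 0` model `V` of the `5`-twist of `326700ga1`** (`W = [0, 0, 0, 0, -1375]`, CM, `j = 0`, `N = 326700`;
Cremona `r_an(W) = 1`; PARI plus-`η` `(λ, μ) = (1, 0)`; census j326603 / j326929 / j326822 (GRH): `h(ℚ(P)) = 360`, `h(ℚ(x(P))) = 18`, `d₂ = 1`, `s_W = 0`; hecke13: TWIST, `c = 3 ≠ Tr = 2` — the plain class-number door and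
door L6⁻ are VOID, the Hecke door passes: the tautological class comes from the ROW curve `V = W^5`, not from `W`) from the ROW ALONE —
named facts `h22 h41 h6273 hGZK`; displayed `r_an(W) = 1`, the tower clause, `(L_5⁺(V,η,X)) = (X)`, the Hecke-refined eigen datum. Instance of
`etaMC_r1_of_heckeEigenHom`. CONDITIONAL; nothing booked. [cite: Kobayashi2003, §4 (p. 8)] [cite: DeoRaySujatha2023, §3 Thm. 3.8]
[cite: Cremona1997, Table 1 (label 326700ga1)] -/
theorem etaMC_r1_326700ga1_5_of_heckeEigenHom
    (h22 : Kobayashi2003.thm22_etaSignedSelmerDual_finite_torsion)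
    (h41 : Kobayashi2003.thm41_plusEtaCharIdeal_dvd)
    (h6273 : Kobayashi2003.thm62_63_73_etaColemanPoitouTate)
    (hGZK : rank_eq_analyticRank_of_analyticRank_le_one) [Fact (5 : ℕ).Prime]
    (W : WeierstrassCurve ℚ) (hW : W = (⟨0, 0, 0, 0, (-1375)⟩ : WeierstrassCurve ℚ)) (hr : W.analyticRank = 1)
    (V : WeierstrassCurve ℚ) [V.IsElliptic] [V.IsGloballyMinimal] (C : VariableChange ℚ)
    (hC : C • W.quadraticTwist 5 = V)
    (hgood : V.HasGoodReductionAtPrime 5) (hap : V.frobeniusTrace 5 = 0)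
    (hns : ¬ ∀ m : ℕ, V.HasSurjectiveModNGaloisRep (5 ^ m : ℕ))
    (hX : ∀ {N : ℕ} [NeZero N] {f : CuspForm (Gamma0 N) 2}, IsNewformOf V f →
      ∀ (ϖ : ℚ), (if Even (5 / 2) then (ϖ : ℝ) * V.realPeriodRat = plusPeriod f
          else (ϖ : ℝ) * V.imaginaryPeriodRat = minusPeriod f) →
      ∀ (Lη : IwasawaAlgebra 5), IsQuadraticBranchPlusLFunction f 5 ϖ Lη →
        Ideal.span {Lη} = Ideal.span {(PowerSeries.X : IwasawaAlgebra 5)})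
    (hP : haveI : W.IsElliptic := hW ▸ isElliptic_326700ga1
      haveI : NeZero (5 : ℕ) := ⟨by norm_num⟩
      haveI : NumberField (W.divisionField 5) := NumberField.mk
      ∃ P : geomTorsion W ((5 : ℕ) : ℤ), P ≠ 0 ∧
        ∀ K : IntermediateField ℚ (W.divisionField 5),
          K = IntermediateField.fixedField
            ((MulAction.stabilizer (absoluteGaloisGroup ℚ) P).map (absRestrictNormalHom (W.divisionField 5))) →
        ∀ μ : Additive (ClassGroup (𝓞 K)) →+ ZMod 5,
          (∀ (τ : absoluteGaloisGroup ℚ) (σ : K ≃ₐ[ℚ] K) (a : ℕ),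
              (∀ x : K, absRestrictNormalHom (W.divisionField 5) τ (x : W.divisionField 5) =
                ((σ x : K) : W.divisionField 5)) → τ • P = a • P →
              ∀ (I J : (Ideal (𝓞 K))⁰),
                (J : Ideal (𝓞 K)) = (I : Ideal (𝓞 K)).map (AmbiguousClass.intAut σ : 𝓞 K →+* 𝓞 K) →
                μ (Additive.ofMul (ClassGroup.mk0 J)) = a • μ (Additive.ofMul (ClassGroup.mk0 I))) →
          (∀ (τ τ₁ : absoluteGaloisGroup ℚ) (a a₁ b : ℕ) (Q : geomTorsion W ((5 : ℕ) : ℤ)),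
              τ • P = a • P + Q → τ₁ • P = a₁ • P → τ₁ • Q = b • Q → (a₁ : ZMod 5) ≠ (b : ZMod 5) →
              ∀ I : (Ideal (𝓞 K))⁰,
                μ (Additive.ofMul (classGroupNorm K (W.divisionField 5) (ClassGroup.mulEquiv
                  (AmbiguousClass.intAut (absRestrictNormalHom (W.divisionField 5) τ))
                    (classGroupExtend K (W.divisionField 5) (ClassGroup.mk0 I))))) =
                  (Nat.card ((W.divisionField 5) ≃ₐ[K] (W.divisionField 5)) * a) •
                    μ (Additive.ofMul (ClassGroup.mk0 I))) →
          μ = 0) :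
    QuadraticBranchPlusEtaMainConjectureAt V 5 := by
  subst hW
  haveI : (⟨0, 0, 0, 0, (-1375)⟩ : WeierstrassCurve ℚ).IsElliptic := isElliptic_326700ga1
  haveI : NeZero (5 : ℕ) := ⟨by norm_num⟩
  exact etaMC_r1_of_heckeEigenHom h22 h41 h6273 hGZK 5 (le_refl 5) _ hr V C
    (by rw [show ((-1 : ℚ) ^ ((5 : ℕ) / 2) * ((5 : ℕ) : ℚ)) = 5 by norm_num]; exact hC) hgood hap hns hX hP

end Summit.BirchSwinnertonDyer.BirchSwinnertonDyer.Theorems.EtaConjADoorHeckeRecords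

end
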